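import Mathlib
import HarnessLib
import Literature.Analysis.FluidPDE.TypeIAncientMild
import Literature.Analysis.FluidPDE.ForcedOseenRepresentationPointwise
import Literature.Analysis.FluidPDE.TaoLocalisationProofs
import Summits.NavierStokesRegularity.NavierStokesRegularity.Theorems.QuarterLogPincerThinCascadeDefs
import Summits.NavierStokesRegularity.NavierStokesRegularity.Theorems.QuarterLogPincerTypeIQuantSubcubicExpZoomLimit
import Summits.NavierStokesRegularity.NavierStokesRegularity.Theorems.QuarterLogPincerTruncationEdgeOseenStability

/-!
# Route `QuarterLogPincer`, crux `TypeIQuantSubcubicExp` (stmt-NavierStokesRegularity-24077), line `truncation_edge` — towards stub T1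
# `stub_farFieldTruncation`: SHADOWING — every Tao-frame solution issued near `v(−1)` follows the ancient field with polynomial loss

Third piece of the typer's T1 groundwork (pub-ns-dss typer g35; helper `--supports stmt-NavierStokesRegularity-24077`), on top of
`…TruncationEdgeOseenStability` (p664453: `L^∞` stability of Oseen-mild fields under a Type-I drift) and
`…TruncationEdgeDivFreeTruncation` (the divergence-free truncated datum).  It removes the a-priori drift hypothesis on the comparison
field by a BOOTSTRAP and delivers clauses (i) and (iii) of T1 for ANY Tao-frame solution from a nearby datum:

* `hasBoundedSobolevNormsOn_of_frame`, `exists_bound_of_taoFrame` — a Tao-frame field (`TaoFrame`, `…ThinCascadeDefs`: classical on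
  `[0,T]` with every `H^k` seminorm bounded) is bounded (Sobolev imbedding, tree `linfty_bound_of_hasBoundedSobolevNormsOn_holds`);
* `taoFrame_mild_eq` — it is Oseen-mild between EVERY pair of times `0 ≤ s < t ≤ T`, pointwise (the tree's forced Oseen representation
  of bounded finite-energy classical solutions, `IsClassicalNSSolutionOn.eq_forced_oseenMild_of_bounded`, zero force);
* `exists_taoFrame_shadow` — **SHADOWING**: with a universal `C` and `m = ⌈64C²(M+1)²⌉`, if `IsTypeIAncientMild M v`, `(u,p)` is
  Tao-frame on `[0,F]`, `F < 1`, and `‖u(0) − v(−1)‖_∞ ≤ η` with `η(2/(1−F))^m ≤ ½`, then on `[0,F]`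
  `‖u(t) − v(t−1)‖_∞ ≤ η(2/(1−t))^m` and `‖u(t,x)‖ ≤ (M+1)/√(1−t)` (the virtual Type-I bound of T1 clause (i), blow-up time `1`).

READING for T1 (`StubFarFieldTruncation`, `Theorems/QuarterLogPincerTruncationEdgeDefs.lean`): for the truncated datum `u₀` of
`…DivFreeTruncation` at radius `R = 2K·A·δ⁻¹·(2/ε)^m` (POLYNOMIAL in `1/ε`, as T1 demands) every Tao-frame solution on `[0, 1−ε]`
from `u₀` satisfies (i) and (iii) (`‖u(1−ε) − v(−ε)‖ ≤ δ` on all of `ℝ³`).  What T1 still needs: the EXISTENCE of that solution on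
`[0,1−ε]` (Tao's local `H¹` theory `tao2011_smooth_local_existence_holds` marched with the enstrophy bound under the drift,
`lintegral_frobeniusNormSq_fderiv_le_mul_exp` — tree facts) and the `L³` clause (ii) (the typer's sizing note, evidence on 24077).
HONEST FRAME: statements about HYPOTHETICAL objects; T1, 24077, 22144 and NS regularity are OPEN and untouched.
-/

noncomputable section

set_option linter.dupNamespace false

namespace Summit.NavierStokesRegularity.NavierStokesRegularity.Theorems.QuarterLogPincerTruncationEdge

open MeasureTheory Set Function Filter Real Metric
open scoped ENNReal NNReal Topology
open Literature.Analysis Literature.Analysis.FluidPDE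
open Summit.NavierStokesRegularity.NavierStokesRegularity.Cruxes.TypeIQuantSubcubicExp.ThinCascade (TaoFrame)
open Summit.NavierStokesRegularity.NavierStokesRegularity.Theorems.ThinCascade
  (frame_finite_energy forceDuhamel_zero_force isWeaklyDivFree_zero_field)

/-! ## Tao-frame fields: Sobolev bookkeeping, sup bound, Oseen identity between every pair of times -/

/-- The `H^k` clause of `TaoFrame` (`eLpNorm`-form) gives `HasBoundedSobolevNormsOn` (`∫⁻ ‖·‖ₑ²`-form). [folklore] -/
theorem hasBoundedSobolevNormsOn_of_frame {T : ℝ}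
    {u : ℝ → EuclideanSpace ℝ (Fin 3) → EuclideanSpace ℝ (Fin 3)}
    (hH : ∀ n : ℕ, ∃ C : NNReal, ∀ t ∈ Icc 0 T, eLpNorm (iteratedFDeriv ℝ n (u t)) 2 volume ≤ C) :
    HasBoundedSobolevNormsOn (Icc 0 T) u := by
  intro n
  obtain ⟨C, hC⟩ := hH n
  refine ⟨C ^ 2, fun t ht => ?_⟩
  have h2 : ∫⁻ x, ‖iteratedFDeriv ℝ n (u t) x‖ₑ ^ 2 = eLpNorm (iteratedFDeriv ℝ n (u t)) 2 volume ^ 2 := by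
    have := eLpNorm_nnreal_pow_eq_lintegral (f := iteratedFDeriv ℝ n (u t)) (μ := volume) (p := 2) two_ne_zero
    rw [← ENNReal.rpow_two]
    push_cast at this
    rw [this]
    refine lintegral_congr fun x => ?_
    rw [← ENNReal.rpow_natCast]; norm_num
  rw [h2]
  push_cast
  exact pow_le_pow_left' (hC t ht) 2

/-- A Tao-frame field is bounded on its closed slab (Sobolev imbedding `H² ⊂ C_B`). [folklore] -/
theorem exists_bound_of_taoFrame {T : ℝ} {u : ℝ → EuclideanSpace ℝ (Fin 3) → EuclideanSpace ℝ (Fin 3)}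
    {p : ℝ → EuclideanSpace ℝ (Fin 3) → ℝ} (hu : TaoFrame T u p) :
    ∃ B : ℝ, 0 < B ∧ ∀ t ∈ Icc 0 T, ∀ x, ‖u t x‖ ≤ B := by
  obtain ⟨C, hC⟩ := linfty_bound_of_hasBoundedSobolevNormsOn_holds
    (fun t ht => (hu.1.contDiff_velocity ht).of_le (by norm_cast)) (hasBoundedSobolevNormsOn_of_frame hu.2)
  exact ⟨max C 0 + 1, by positivity, fun t ht x => (hC t ht x).trans (by linarith [le_max_left C 0])⟩

/-- **A Tao-frame field is Oseen-mild between every pair of times** `0 ≤ s < t ≤ T` (pointwise): the tree's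
forced Oseen representation of bounded finite-energy classical solutions, with zero force. [folklore] -/
theorem taoFrame_mild_eq {T : ℝ} {u : ℝ → EuclideanSpace ℝ (Fin 3) → EuclideanSpace ℝ (Fin 3)}
    {p : ℝ → EuclideanSpace ℝ (Fin 3) → ℝ} (hu : TaoFrame T u p) :
    ∀ s t : ℝ, 0 ≤ s → s < t → t ≤ T → ∀ x,
      u t x = heatFlow (u s) (t - s) x - oseenDuhamel 1 s u u t x := by
  intro s t hs hst htT x
  obtain ⟨B, hB, hbd⟩ := exists_bound_of_taoFrame hu
  have hE := frame_finite_energy hu.2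
  have h := hu.1.eq_forced_oseenMild_of_bounded one_pos
    (g := (0 : ℝ → EuclideanSpace ℝ (Fin 3) → EuclideanSpace ℝ (Fin 3)))
    (G := 0) continuous_const (fun _ _ => by simp)
    (fun _ _ => isWeaklyDivFree_zero_field) (G₂ := 0) ENNReal.zero_ne_top
    (fun _ _ => by simp) hE hB hbd hs hst htT x
  rw [one_mul, forceDuhamel_zero_force, add_zero, ← heatFlow_of_pos _ (sub_pos.2 hst)] at h
  exact h

/-! ## Shadowing: every Tao-frame solution issued near `v(−1)` follows `v` with polynomial loss -/

/-- **SHADOWING THEOREM (T1 clauses (i) + (iii) for ANY Tao-frame solution from a nearby datum).**  There is a universal `C > 0`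
such that, with `m := ⌈64C²(M+1)²⌉`: if `v` is a Type-I ancient mild field (`IsTypeIAncientMild M v`, `M ≥ 0`), `(u, p)` is a
Tao-frame solution on `[0, F]`, `0 < F < 1`, whose datum satisfies `‖u(0,·) − v(−1,·)‖ ≤ η` with `η·(2/(1−F))^m ≤ ½`, then for all
`t ∈ [0, F]`: `‖u(t,x) − v(t−1,x)‖ ≤ η·(2/(1−t))^m` (hence `≤ ½`) and the virtual Type-I bound `‖u(t,x)‖ ≤ (M+1)/√(1−t)` holds.
BOOTSTRAP: the frame field is bounded (Sobolev) and Oseen-mild between pairs (`taoFrame_mild_eq`), `v(·−1)` likewise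
(`IsTypeIAncientMild`); on a uniform grid of short steps the one-step doubling (`exists_oseenMild_sub_step`) keeps `‖u − v̄‖ ≤ 1`,
which gives `u` the drift bound `(M+1)/√(1−t)`, under which the polynomial estimate (`exists_oseenMild_sub_le_of_typeI`) restores the
sharp bound.  READING for T1: clause (iii) (`δ`-closeness on `B(1)` at `t = 1−ε`, indeed on all of `ℝ³`) and clause (i) hold for EVERY
Tao-frame solution on `[0,1−ε]` from a datum within `η ≤ ½·δ·(ε/2)^m` of `v(−1)` — e.g. the divergence-free truncation of
`…TruncationEdgeDivFreeTruncation` at radius `R = 2K·A·δ⁻¹(2/ε)^m` (POLYNOMIAL in `1/ε`); what T1 still needs is the EXISTENCE of that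
solution on `[0, 1−ε]` (Tao's local theory + the enstrophy bound under the drift, tree facts) and clause (ii). [folklore] -/
theorem exists_taoFrame_shadow :
    ∃ C : ℝ, 0 < C ∧ ∀ {M : ℝ} {v u : ℝ → EuclideanSpace ℝ (Fin 3) → EuclideanSpace ℝ (Fin 3)}
      {p : ℝ → EuclideanSpace ℝ (Fin 3) → ℝ} {F η : ℝ},
      IsTypeIAncientMild M v → 0 ≤ M → TaoFrame F u p → 0 < F → F < 1 →
      (∀ y, ‖u 0 y - v (-1) y‖ ≤ η) →
      η * (2 / (1 - F)) ^ ⌈64 * C ^ 2 * (M + 1) ^ 2⌉₊ ≤ 1 / 2 →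
      ∀ t ∈ Icc 0 F, ∀ x,
        ‖u t x - v (t - 1) x‖ ≤ η * (2 / (1 - t)) ^ ⌈64 * C ^ 2 * (M + 1) ^ 2⌉₊ ∧
        ‖u t x‖ ≤ (M + 1) / Real.sqrt (1 - t) := by
  obtain ⟨C, hC, hTI⟩ := exists_oseenMild_sub_le_of_typeI
  obtain ⟨C', hC', hstep⟩ := exists_oseenMild_sub_step
  refine ⟨C, hC, ?_⟩
  intro M v u p F η hv hM hu hF hF1 hη hsmall
  set m : ℕ := ⌈64 * C ^ 2 * (M + 1) ^ 2⌉₊ with hm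
  have hη0 : 0 ≤ η := (norm_nonneg _).trans (hη 0)
  -- the shifted ancient field `v̄(t) = v(t − 1)`
  set vb : ℝ → EuclideanSpace ℝ (Fin 3) → EuclideanSpace ℝ (Fin 3) := fun t => v (t - 1) with hvb
  have hvb_cont : ContinuousOn (uncurry vb) (Icc 0 F ×ˢ univ) := by
    have h1 : ContinuousOn (uncurry v) (Iio 0 ×ˢ univ) := hv.continuousOn_uncurry
    have hφ : Continuous fun q : ℝ × EuclideanSpace ℝ (Fin 3) => (q.1 - 1, q.2) :=
      (continuous_fst.sub continuous_const).prodMk continuous_snd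
    refine (h1.comp hφ.continuousOn fun q hq => ⟨?_, mem_univ _⟩)
    simp only [mem_prod, mem_Icc] at hq
    show q.1 - 1 < 0
    linarith [hq.1.2]
  have hvb_mild : ∀ s t : ℝ, 0 ≤ s → s < t → t ≤ F → ∀ x,
      vb t x = heatFlow (vb s) (t - s) x - oseenDuhamel 1 s vb vb t x := by
    intro s t hs hst htF x
    have h := hv.mild_eq (s := s - 1) (t := t - 1) (by linarith) (by linarith) x
    simp only [hvb]
    rw [h, show t - 1 - (s - 1) = t - s by ring, oseenDuhamel_comp_sub_right]
  have hvb_bd : ∀ τ ∈ Icc 0 F, ∀ y, ‖vb τ y‖ ≤ M / Real.sqrt (1 - τ) := by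
    intro τ hτ y
    have := hv.norm_le (t := τ - 1) (by linarith [hτ.2]) y
    simpa [hvb, show -(τ - 1) = 1 - τ by ring] using this
  have hvb_bd' : ∀ τ ∈ Icc 0 F, ∀ y, ‖vb τ y‖ ≤ (M + 1) / Real.sqrt (1 - τ) := fun τ hτ y =>
    (hvb_bd τ hτ y).trans (div_le_div_of_nonneg_right (by linarith) (Real.sqrt_nonneg _))
  -- the frame field
  have hu_cont : ContinuousOn (uncurry u) (Icc 0 F ×ˢ univ) := hu.1.smooth_velocity.continuousOn
  have hu_mild := taoFrame_mild_eq hu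
  obtain ⟨B, hB, hu_bd⟩ := exists_bound_of_taoFrame hu
  -- a uniform crude bound for both fields on `[0,F]`, and the step length
  have hsq : 0 < Real.sqrt (1 - F) := Real.sqrt_pos.2 (by linarith)
  set U : ℝ := B + (M + 1) / Real.sqrt (1 - F) with hU
  have hUpos : 0 < U := by positivity
  have hvbU : ∀ τ ∈ Icc 0 F, ∀ y, ‖vb τ y‖ ≤ U := by
    intro τ hτ y
    refine (hvb_bd' τ hτ y).trans ?_
    have h1 : (M + 1) / Real.sqrt (1 - τ) ≤ (M + 1) / Real.sqrt (1 - F) :=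
      div_le_div_of_nonneg_left (by linarith) hsq (Real.sqrt_le_sqrt (by linarith [hτ.2]))
    linarith [hB]
  have huU : ∀ τ ∈ Icc 0 F, ∀ y, ‖u τ y‖ ≤ U := fun τ hτ y =>
    (hu_bd τ hτ y).trans (by rw [hU]; linarith [div_nonneg (by linarith : (0:ℝ) ≤ M + 1) hsq.le])
  set h : ℝ := 1 / (64 * C' ^ 2 * U ^ 2) with hh
  have hhpos : 0 < h := by positivity
  have hsqrt_h : Real.sqrt h = 1 / (8 * C' * U) := by
    rw [show h = (1 / (8 * C' * U)) ^ 2 by rw [hh]; field_simp; ring]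
    exact Real.sqrt_sq (by positivity)
  -- the sharp bound on an initial segment where the drift bound is known
  have hsharp : ∀ T : ℝ, 0 ≤ T → T ≤ F →
      (∀ τ ∈ Icc 0 T, ∀ y, ‖u τ y‖ ≤ (M + 1) / Real.sqrt (1 - τ)) →
      ∀ t ∈ Icc 0 T, ∀ x, ‖u t x - vb t x‖ ≤ η * (2 / (1 - t)) ^ m := by
    intro T hT0 hTF hdrift t ht x
    have hsub : Icc 0 T ×ˢ (univ : Set (EuclideanSpace ℝ (Fin 3))) ⊆ Icc 0 F ×ˢ univ :=
      prod_mono (Icc_subset_Icc le_rfl hTF) subset_rfl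
    have := hTI (a := 0) (T := T) (T₀ := 1) (M := M + 1) (η := η) hT0 (by linarith)
      (hu_cont.mono hsub) (hvb_cont.mono hsub)
      (fun s t' hs hst' ht' x' => hu_mild s t' hs hst' (ht'.trans hTF) x')
      (fun s t' hs hst' ht' x' => hvb_mild s t' hs hst' (ht'.trans hTF) x')
      (by linarith) hdrift (fun τ hτ y => hvb_bd' τ ⟨hτ.1, hτ.2.trans hTF⟩ y)
      (fun y => by simpa [hvb] using hη y) t ht x
    simpa [sub_zero] using this
  -- grid induction: the drift bound propagates along steps of length `h`
  have hgrid : ∀ k : ℕ, ∀ τ ∈ Icc 0 F, τ ≤ k * h → ∀ y, ‖u τ y‖ ≤ (M + 1) / Real.sqrt (1 - τ) := by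
    intro k
    induction k with
    | zero =>
      intro τ hτ hτk y
      have hτ0 : τ = 0 := le_antisymm (by simpa using hτk) hτ.1
      rw [hτ0]
      have h1 : ‖u 0 y - vb 0 y‖ ≤ η := by simpa [hvb] using hη y
      have h2 : η ≤ 1 := by
        have : (1:ℝ) ≤ (2 / (1 - F)) ^ m := one_le_pow₀ (by rw [le_div_iff₀ (by linarith)]; linarith)
        nlinarith
      have h3 := hvb_bd 0 ⟨le_rfl, hF.le⟩ y
      calc ‖u 0 y‖ ≤ ‖vb 0 y‖ + ‖u 0 y - vb 0 y‖ := norm_le_insert' _ _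
        _ ≤ M / Real.sqrt (1 - 0) + 1 := add_le_add h3 (h1.trans h2)
        _ ≤ (M + 1) / Real.sqrt (1 - 0) := by simp
    | succ k ih =>
      intro τ hτ hτk y
      by_cases hle : τ ≤ k * h
      · exact ih τ hτ hle y
      push Not at hle
      -- the base point `s = k h < τ ≤ F`
      set s : ℝ := k * h with hs
      have hs0 : 0 ≤ s := by positivity
      have hsF : s ≤ F := hle.le.trans hτ.2
      -- sharp bound at `s` from the induction hypothesis on `[0, s]`
      have hws : ∀ y, ‖u s y - vb s y‖ ≤ η * (2 / (1 - s)) ^ m :=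
        fun y => hsharp s hs0 hsF (fun σ hσ z => ih σ ⟨hσ.1, hσ.2.trans hsF⟩ hσ.2 z) s ⟨hs0, le_rfl⟩ y
      -- one doubling step on `[s, T']`, `T' = min F (s + h)`
      set T' : ℝ := min F (s + h) with hT'
      have hsT' : s < T' := lt_min (lt_of_lt_of_le hle hτ.2) (by linarith)
      have hT'F : T' ≤ F := min_le_left _ _
      have hτT' : τ ≤ T' := le_min hτ.2 (by
        have : ((k + 1 : ℕ) : ℝ) * h = k * h + h := by push_cast; ring
        linarith)
      have hsub : Icc s T' ×ˢ (univ : Set (EuclideanSpace ℝ (Fin 3))) ⊆ Icc 0 F ×ˢ univ :=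
        prod_mono (Icc_subset_Icc hs0 hT'F) subset_rfl
      have hshort : 8 * C' * U * Real.sqrt (T' - s) ≤ 1 := by
        have h1 : Real.sqrt (T' - s) ≤ Real.sqrt h := Real.sqrt_le_sqrt (by linarith [min_le_right F (s + h)])
        calc 8 * C' * U * Real.sqrt (T' - s) ≤ 8 * C' * U * Real.sqrt h :=
              mul_le_mul_of_nonneg_left h1 (by positivity)
          _ = 1 := by rw [hsqrt_h]; field_simp
      have hdouble := hstep hsT' (hu_cont.mono hsub) (hvb_cont.mono hsub)
        (fun t' ht' x' => hu_mild s t' hs0 ht'.1 (ht'.2.trans hT'F) x')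
        (fun t' ht' x' => hvb_mild s t' hs0 ht'.1 (ht'.2.trans hT'F) x')
        hUpos (fun σ hσ z => huU σ ⟨hs0.trans hσ.1, hσ.2.trans hT'F⟩ z)
        (fun σ hσ z => hvbU σ ⟨hs0.trans hσ.1, hσ.2.trans hT'F⟩ z) hws hshort τ ⟨hle.le, hτT'⟩ y
      -- `2 η (2/(1−s))^m ≤ 1`
      have hpow : (2 / (1 - s)) ^ m ≤ (2 / (1 - F)) ^ m := by
        have h1s : 0 < 1 - s := by linarith
        refine pow_le_pow_left₀ (div_nonneg zero_le_two h1s.le) ?_ m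
        exact div_le_div_of_nonneg_left zero_le_two (by linarith : (0:ℝ) < 1 - F) (by linarith)
      have hw1 : ‖u τ y - vb τ y‖ ≤ 1 := by
        refine hdouble.trans ?_
        nlinarith [mul_le_mul_of_nonneg_left hpow hη0]
      have h3 := hvb_bd τ hτ y
      have hsqτ : 0 < Real.sqrt (1 - τ) := Real.sqrt_pos.2 (by linarith [hτ.2])
      have hsq1 : Real.sqrt (1 - τ) ≤ 1 := by
        rw [Real.sqrt_le_one]; linarith [hτ.1]
      calc ‖u τ y‖ ≤ ‖vb τ y‖ + ‖u τ y - vb τ y‖ := norm_le_insert' _ _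
        _ ≤ M / Real.sqrt (1 - τ) + 1 := add_le_add h3 hw1
        _ ≤ (M + 1) / Real.sqrt (1 - τ) := by
            rw [add_div]
            refine add_le_add le_rfl ?_
            rw [le_div_iff₀ hsqτ]; linarith
  -- conclusion
  have hdriftF : ∀ τ ∈ Icc 0 F, ∀ y, ‖u τ y‖ ≤ (M + 1) / Real.sqrt (1 - τ) := by
    intro τ hτ y
    obtain ⟨k, hk⟩ := exists_nat_ge (F / h)
    refine hgrid k τ hτ (hτ.2.trans ?_) y
    rwa [div_le_iff₀ hhpos] at hk
  intro t ht x
  exact ⟨hsharp F hF.le le_rfl hdriftF t ht x, hdriftF t ht x⟩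

end Summit.NavierStokesRegularity.NavierStokesRegularity.Theorems.QuarterLogPincerTruncationEdge

end
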